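import Literature.MathematicalPhysics.QuantumFieldTheory.Balaban1983to89.B6Partition118KLevelTorusChartL0
import Literature.MathematicalPhysics.QuantumFieldTheory.Balaban1983to89.B6Partition118KLevelFineLipL0
import Literature.MathematicalPhysics.QuantumFieldTheory.Balaban1983to89.B6TorusDepthDistanceL0
import Literature.MathematicalPhysics.QuantumFieldTheory.Balaban1983to89.B6Partition118KLevelTorusCentral
/-!
# `Balaban1983to89.B6Partition118KLevelTorusCentralL0` — LEVEL-0 TWIN (programme G-F3′-L0, director-ym LINE №27 / UV3-NODE §24.5; plan `lit-balaban-r03/G-F3L0-PLAN.md`) of `B6Partition118KLevelTorusCentral`: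
the same declarations, SAME NAMES AND STATEMENTS, for nested families WITH print's region `Λ₀ = T ∖ Ω₁` ADMITTED (structures
`B6MultiLevelBoxOperatorL0.Domains` / `B6MultiLevelTorusOperatorL0.TDomains`: levels `0, …, k`, the level-`0` block a single site, `Q′₀ = id`,
finite weight `a₀` — print p.225 (2.14) «Σ_{j=0}^k … (Q′₀λ)(x) = λ(x), x ∈ Λ₀», p.229 «taking a sequence (2.1) … smallest possible domains B^j(Λ_j),
and considering the operator Δ_a defined by (2.19), (2.20) for this sequence»).  Every `D`-free object is the lineage's, consumed BY NAME; no existing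
module is touched; no fact is minted.  Unit `lit-balaban-r03` (B6 fold owner, r03 gen 36); referee ref-4.  THE TWIN'S DOCUMENTATION FOLLOWS
VERBATIM (its «levels 1 … k» / «Ω₁ = X» sentences describe the twin; here `j` runs from `0` and `Ω₁` may be a proper subset).

# `Balaban1983to89.B6Partition118KLevelTorusCentral` — T. Bałaban, *Propagators and renormalization transformations for lattice gauge theories. II*,
# Commun. Math. Phys. **96** (1984) 223–250 [Balaban1984PropagatorsII], (2.36) p. 229, (2.89)–(2.92) p. 239, (2.134) p. 247: EACH TORUS CUBE AS THE CENTRAL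
# CUBE OF ITS CANONICAL CHART — p21's chart `svec`/central label `qc` (`…B6Eq238MultiLevelTorus`) for the cubes of the periodic partition `{h^T_□}`, the
# depth of the central cube and of its collar, and the supports `S_□`, cut-off sets `□̃` and `ζ_□` as TORUS blocks (file 3 of route (A) of B6-CLOSURE §5
# item 11 / GAPS G-B6-p38-04; file 4 `…TorusBinders` = the (2.134) binders in the torus metric)

statement-level skeleton of published theorems with citation tags; proofs where landed; nothing here is a claim about the Yang–Mills mass gap

PDF held: `paper:balaban1984-cmp96-propagators-rt-ii` (journal page = PDF page + 222): p. 229 [PDF 7] ((2.36)), p. 231 [PDF 9] ((2.46)), p. 235 [PDF 13] (the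
enlarged cubes), p. 239 [PDF 17] ((2.89)–(2.92): *"the corresponding family of functions ζ_□ ∈ C₀^∞(□̃)"*), p. 247 [PDF 25] ((2.134)); read from the tree
transcriptions in `…B6Eq238MultiLevelTorus` (p21: every torus cube is a CENTRAL box cube of a translated family), `…B6Partition118KLevelFineLip`,
`…B6TorusDepthDistance`.

CITATION HEADER (lean-in-tree rule) — WHAT IS REPRODUCED.  Phase-2 file of the `lit-balaban` typed skeleton (HOME `run/shared/lean/pub/lit-balaban/`), seat
**p38 gen 26**; SKELETON rows **B6.Eq2.36** × **B6.Eq2.134** × **B6.Eq2.91** (cells only; decls of record untouched; owner r03, referee ref-4).  File 1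
(`…B6Partition118KLevelTorus`) built the periodic family `hT` with `Σ_□ hT² = 1` on `T_η`; file 2 (`…Chart`) proved that a `CtrDeep` cube of ANY chart reads
it as gen 25's box family.  THIS FILE fixes, for every torus cube `c = (j, β) ∈ cubes D.toDomains`, p21's chart `svec ℓ k j β` (torus translation by a
multiple of `M·L^k`; top big block of the cube at index `2`) and:
* §1 the central cube `cc c = (j, qc ℓ k j β)` of the chart family `Dch D c := (D.chart (svec …)).toDomains` (`cTinv_svec_eq`, `cc_mem`, `cubesEquiv_cc`), its
  centre bounds `2S_k + S/2 ≤ ctr_μ`, `ctr_μ + (P_μ − 3)S_k + S/2 ≤ N₀_μ` (`ctr_cc_bounds`), `CtrDeep` for `P_μ ≥ 4` (`ctrDeep_cc`), and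
  **`hT D c z = hF (Dch D c) (cc c) (σ_c⁻¹ z)`** (`hT_eq_hF_cc`, `hT_eq_pullT` — file 2's dictionary in the canonical chart);
* §2 DEPTH (`P_μ ≥ 5`, `M_h ≥ 2`, `R ≥ 2L`): every site within `3S/2` of the centre is `S_k`-deep (`siteDeep_of_dist_le`); the blocks carrying `supp h_□` and
  the blocks of `□⁺ = Q` are `S_k`-deep of level `≤ j + 1` (`blkDeep_of_hF_ne_zero`, `blkDeep_of_mem_Q`) — the `hdeep` inputs of gen 25's
  `…B6TorusDepthDistanceL0.lip_transfer`/`gap_transfer`;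
* §2b THE TWO-LEVEL WINDOW OF THE COLLAR (`two_level_collar`): `∃ j₀ ∈ {j − 1, j}`, every chart site within `3S/2` of the centre has chart level `j₀` or
  `j₀ + 1` (p21's `lev_window`/`not_both_sides` at the cube's witness) — r03's `hlev` for any window inside the collar (`lev_σch` reads it on the torus);
* §3 the sets `QT c := blkMap(Q)`, `QbigT c := blkMap(Qbig)` of TORUS blocks and `zetaT c` (indicator of `QbigT`): the binders `hhS`
  (`blkOf_mem_QT_of_hT_ne_zero`), `hζ0`, `hζ1`, `hζS`, and `ζ_□h^T_□ = h^T_□`.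
No `def : Prop`, no new fact; defs with bodies (`Dch`, `σch`, `cc`, `QT`, `QbigT`, `zetaT`); standard axioms.
HONEST SCOPE / DIVERGENCES. As files 1–2 and gen 25 (normalisation across levels ours; `ζ_□` an indicator of blocks — no derivative of `ζ_□` enters
(2.92)/(2.134), cell decision r03 g18; constants `L`,`d`-dependent); `P_μ ≥ 4` resp. `≥ 5` top blocks per direction (print's torus is astronomically larger than
a cube); the canonical chart is ONE admissible choice — file 2 serves any chart in which the cube is `CtrDeep`.  Integer torus; nothing on d = 4 or the
continuum; NOT summit progress.  Unit `lit-balaban-p38` (gen 26), 2026-08-23.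
-/

namespace Literature.MathematicalPhysics.QuantumFieldTheory.Balaban1983to89.B6Partition118KLevelTorusCentralL0

open Finset
open Literature.MathematicalPhysics.QuantumFieldTheory.Balaban1983to89.B4Reflection242 (boxDom mem_boxDom blk)
open Literature.MathematicalPhysics.QuantumFieldTheory.Balaban1983to89.B6MultiLevelBoxOperator (N0 bigSide bigSide_eq one_le_bigSide)
open Literature.MathematicalPhysics.QuantumFieldTheory.Balaban1983to89.B6MultiLevelBoxOperatorL0 (Domains)
open Literature.MathematicalPhysics.QuantumFieldTheory.Balaban1983to89.B6MultiLevelTorusOperator (twrap_eq_self tshift)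
open Literature.MathematicalPhysics.QuantumFieldTheory.Balaban1983to89.B6MultiLevelTorusOperatorL0 (TDomains)
open Literature.MathematicalPhysics.QuantumFieldTheory.Balaban1983to89.B6Geom246MultiLevelBox (toR)
open Literature.MathematicalPhysics.QuantumFieldTheory.Balaban1983to89.B6Geom246MultiLevelBoxL0 (bset blkOf cen dist_toR_cen_le)
open Literature.MathematicalPhysics.QuantumFieldTheory.Balaban1983to89.B6Geom246MultiLevelTorusL0 (blkMap)
open Literature.MathematicalPhysics.QuantumFieldTheory.Balaban1983to89.B6Cover236MultiLevelBlocksL0 (cubes side side_eq side_pos ctr Q mem_Q window)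
open Literature.MathematicalPhysics.QuantumFieldTheory.Balaban1983to89.B6Eq238MultiLevelBox (Pj)
open Literature.MathematicalPhysics.QuantumFieldTheory.Balaban1983to89.B6Eq238MultiLevelTorus (rj one_le_rj svec qc q_eq_qc_add bigSide_k_eq N0_eq_mul_Pj Pj_eq)
open Literature.MathematicalPhysics.QuantumFieldTheory.Balaban1983to89.B6Partition118KLevelFineL0 (hF dist_lt_of_hF_ne_zero lev_window_of_hF_ne_zero blkOf_mem_Q_of_hF_ne_zero)
open Literature.MathematicalPhysics.QuantumFieldTheory.Balaban1983to89.B6Partition118KLevelFineLipL0 (Qbig Q_subset_Qbig)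
open Literature.MathematicalPhysics.QuantumFieldTheory.Balaban1983to89.B6TorusDepthDistance (SiteDeep)
open Literature.MathematicalPhysics.QuantumFieldTheory.Balaban1983to89.B6TorusDepthDistanceL0 (BlkDeep pullT pullT_apply blkOf_eq_blkMap_symm)
open Literature.MathematicalPhysics.QuantumFieldTheory.Balaban1983to89.B6Partition118KLevelTorusL0 (hT)
open Literature.MathematicalPhysics.QuantumFieldTheory.Balaban1983to89.B6Partition118KLevelTorusChart (cT cTinv)
open Literature.MathematicalPhysics.QuantumFieldTheory.Balaban1983to89.B6Partition118KLevelTorusChartL0 (cTinv_mem cT_cTinv cubesEquiv cubesEquiv_apply_val CtrDeep hT_eq_hF_chart_symm label_mem_boxDom side_le_bigSide_k)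
open Literature.MathematicalPhysics.QuantumFieldTheory.Balaban1983to89.B6Partition118KLevelTorusCentral (one_le_of_four_le two_le_of_four_le qc_bounds_rj cTinv_svec_eq pow_le_half_bigSide)

variable {d : ℕ} {ℓ Mh k R : ℕ} {P : Fin (d + 1) → ℕ}

/-! ## §1  The canonical chart of a torus cube and its central cube -/

section Central

/-- the level of a cube is in `[0, k]` (LEVEL-0 TWIN: the first conjunct is vacuous and kept for positional compatibility with the twin's
`1 ≤ c.1.1 ∧ c.1.1 ≤ k`). [cite: Balaban1984PropagatorsII, (2.3)–(2.4) p.224 («j = 0, 1, …, k»), bookkeeping] -/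
theorem level_bounds (D' : Domains d ℓ Mh k P R) (c : ↥(cubes D')) : 0 ≤ c.1.1 ∧ c.1.1 ≤ k := by
  obtain ⟨x, _, hx⟩ := Finset.mem_image.1 c.2
  rw [← hx]; exact ⟨Nat.zero_le _, D'.lev_le x⟩

variable (D : TDomains d ℓ Mh k P R)

/-- **THE CANONICAL CHART FAMILY OF THE TORUS CUBE `c = (j, β)`**: the box family of p21's chart `svec ℓ k j β`. [cite: Balaban1984PropagatorsII, (2.1)–(2.2) p.224, dictionary (charts)] -/
abbrev Dch (c : ↥(cubes D.toDomains)) : Domains d ℓ Mh k P R := (D.chart (svec ℓ k c.1.1 c.1.2)).toDomains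

/-- **THE CANONICAL CHART TRANSLATION `σ_c`** of the torus cube `c` (by `(M·L^k)·svec`). [cite: Balaban1984PropagatorsII, p.229, dictionary (charts)] -/
abbrev σch (c : ↥(cubes D.toDomains)) : ↥(boxDom (N0 ℓ Mh k P)) ≃ ↥(boxDom (N0 ℓ Mh k P)) :=
  tshift (N0 ℓ Mh k P) (B6MultiLevelTorusOperator.TDomains.tvec ℓ Mh k (svec ℓ k c.1.1 c.1.2))

variable {D}

/-- the central label is a cube of the canonical chart family. [cite: Balaban1984PropagatorsII, (2.36) p.229, dictionary (charts)] -/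
theorem cc_mem (hMh : 1 ≤ Mh) (hP4 : ∀ μ, 4 ≤ P μ) (c : ↥(cubes D.toDomains)) : (c.1.1, qc ℓ k c.1.1 c.1.2) ∈ cubes (Dch D c) := by
  rw [← cTinv_svec_eq hP4 c.1]
  exact cTinv_mem hMh (one_le_of_four_le hP4) _ c.2

variable (D)

/-- **THE CENTRAL CUBE `(j, qc)`** of the torus cube `c = (j, β)` in its canonical chart, as a cube of the chart family `Dch D c`.
[cite: Balaban1984PropagatorsII, (2.36) p.229, dictionary (charts)] -/
def cc (hMh : 1 ≤ Mh) (hP4 : ∀ μ, 4 ≤ P μ) (c : ↥(cubes D.toDomains)) : ↥(cubes (Dch D c)) :=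
  ⟨(c.1.1, qc ℓ k c.1.1 c.1.2), cc_mem hMh hP4 c⟩

variable {D}

/-- the central cube transports back to `c`. [cite: Balaban1984PropagatorsII, (2.36) p.229, dictionary (charts)] -/
theorem cubesEquiv_cc (hMh : 1 ≤ Mh) (hP4 : ∀ μ, 4 ≤ P μ) (c : ↥(cubes D.toDomains)) :
    cubesEquiv D hMh (one_le_of_four_le hP4) (svec ℓ k c.1.1 c.1.2) (cc D hMh hP4 c) = c := by
  apply Subtype.ext
  rw [cubesEquiv_apply_val]
  show cT ℓ k P (svec ℓ k c.1.1 c.1.2) (c.1.1, qc ℓ k c.1.1 c.1.2) = c.1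
  rw [← cTinv_svec_eq hP4 c.1]
  exact cT_cTinv hMh _ c.2

/-- the side of the central cube is `S_j`, the side of `c`'s big block. [cite: Balaban1984PropagatorsII, p.229, bookkeeping] -/
theorem side_cc (hMh : 1 ≤ Mh) (hP4 : ∀ μ, 4 ≤ P μ) (c : ↥(cubes D.toDomains)) : side (Dch D c) (cc D hMh hP4 c) = (bigSide ℓ Mh c.1.1 : ℝ) := rfl

/-- **THE CENTRE OF THE CENTRAL CUBE IS WALL-FAR**: `2S_k + S/2 ≤ ctr_μ` and `ctr_μ + (P_μ − 3)S_k + S/2 ≤ N₀_μ` (`S = S_j`, `S_k = M·L^k`).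
[cite: Balaban1984PropagatorsII, p.229, dictionary (charts)] -/
theorem ctr_cc_bounds (hMh : 1 ≤ Mh) (hP4 : ∀ μ, 4 ≤ P μ) (c : ↥(cubes D.toDomains)) (μ : Fin (d + 1)) :
    2 * (bigSide ℓ Mh k : ℝ) + (bigSide ℓ Mh c.1.1 : ℝ) / 2 ≤ ctr (Dch D c) (cc D hMh hP4 c) μ ∧
      ctr (Dch D c) (cc D hMh hP4 c) μ + ((P μ : ℝ) - 3) * (bigSide ℓ Mh k : ℝ) + (bigSide ℓ Mh c.1.1 : ℝ) / 2 ≤ N0 ℓ Mh k P μ := by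
  have hjk : c.1.1 ≤ k := (level_bounds D.toDomains c).2
  obtain ⟨h0, h1⟩ := qc_bounds_rj (ℓ := ℓ) (k := k) c.1.1 c.1.2 μ
  have h0r : 2 * (rj ℓ k c.1.1 : ℝ) ≤ (qc ℓ k c.1.1 c.1.2 μ : ℝ) := by exact_mod_cast h0
  have h1r : (qc ℓ k c.1.1 c.1.2 μ : ℝ) + 1 ≤ 3 * (rj ℓ k c.1.1 : ℝ) := by exact_mod_cast h1
  have eSk : (bigSide ℓ Mh k : ℝ) = (bigSide ℓ Mh c.1.1 : ℝ) * (rj ℓ k c.1.1 : ℝ) := by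
    rw [bigSide_k_eq (ℓ := ℓ) (Mh := Mh) hjk, bigSide_eq]; push_cast; ring
  have eN : (N0 ℓ Mh k P μ : ℝ) = (bigSide ℓ Mh c.1.1 : ℝ) * (rj ℓ k c.1.1 : ℝ) * (P μ : ℝ) := by
    rw [N0_eq_mul_Pj hjk μ, bigSide_eq, Pj_eq]; push_cast; ring
  have ec : ctr (Dch D c) (cc D hMh hP4 c) μ = ((qc ℓ k c.1.1 c.1.2 μ : ℝ) + 1 / 2) * (bigSide ℓ Mh c.1.1 : ℝ) := rfl
  have hS : (0 : ℝ) ≤ (bigSide ℓ Mh c.1.1 : ℝ) := by positivity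
  rw [ec, eSk, eN]
  constructor <;> nlinarith

/-- **THE CENTRAL CUBE IS `CtrDeep`** (centre `(S + S_k/2)`-deep) for `P_μ ≥ 4`. [cite: Balaban1984PropagatorsII, p.229, dictionary (charts)] -/
theorem ctrDeep_cc (hMh : 1 ≤ Mh) (hP4 : ∀ μ, 4 ≤ P μ) (c : ↥(cubes D.toDomains)) : CtrDeep (Dch D c) (cc D hMh hP4 c) := by
  intro μ
  obtain ⟨h1, h2⟩ := ctr_cc_bounds hMh hP4 c μ
  have hP : (4 : ℝ) ≤ P μ := by exact_mod_cast hP4 μ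
  have hS : side (Dch D c) (cc D hMh hP4 c) ≤ (bigSide ℓ Mh k : ℝ) := side_le_bigSide_k _ _
  rw [side_cc] at hS ⊢
  have hSk : (0 : ℝ) ≤ (bigSide ℓ Mh k : ℝ) := by positivity
  constructor <;> nlinarith

/-- **`h^T_c` IS THE BOX FUNCTION OF THE CENTRAL CUBE READ IN THE CANONICAL CHART**: `hT D c z = hF (Dch D c) (cc c) (σ_c⁻¹ z)`.
[cite: Balaban1984PropagatorsII, (2.36) p.229, dictionary (charts)] -/
theorem hT_eq_hF_cc (hMh : 1 ≤ Mh) (hP4 : ∀ μ, 4 ≤ P μ) (c : ↥(cubes D.toDomains)) (z : ↥(boxDom (N0 ℓ Mh k P))) :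
    hT D c z = hF (Dch D c) (cc D hMh hP4 c) ((σch D c).symm z) := by
  have h := hT_eq_hF_chart_symm (D := D) hMh (two_le_of_four_le hP4) (svec ℓ k c.1.1 c.1.2) (cc D hMh hP4 c) (ctrDeep_cc hMh hP4 c) z
  rw [cubesEquiv_cc hMh hP4 c] at h
  exact h

/-- the same as `hT D c = pullT svec (hF (Dch D c) (cc c))` (the input shape of gen 25's transfers). [cite: Balaban1984PropagatorsII, (2.36) p.229, dictionary (charts)] -/
theorem hT_eq_pullT (hMh : 1 ≤ Mh) (hP4 : ∀ μ, 4 ≤ P μ) (c : ↥(cubes D.toDomains)) :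
    hT D c = pullT (svec ℓ k c.1.1 c.1.2) (hF (Dch D c) (cc D hMh hP4 c)) :=
  funext fun z => by rw [pullT_apply]; exact hT_eq_hF_cc hMh hP4 c z

/-- the torus level of `σ_c x` is the chart level of `x`: the torus block of `σ_c x` has the level of the chart block of `x`.
[cite: Balaban1984PropagatorsII, (2.3)–(2.4) p.224, dictionary (charts)] -/
theorem lev_blkOf_σch (c : ↥(cubes D.toDomains)) (x : ↥(boxDom (N0 ℓ Mh k P))) :
    (blkOf D.toDomains (σch D c x)).1.1 = (blkOf (Dch D c) x).1.1 := by
  show D.lev (σch D c x).1 = (D.chart (svec ℓ k c.1.1 c.1.2)).lev x.1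
  rw [D.chart_lev]

end Central

/-! ## §2  Depth: the collar of the central cube is `S_k`-deep -/

section Depth

variable {D : TDomains d ℓ Mh k P R}

/-- **EVERY SITE WITHIN `3S/2` OF THE CENTRE OF THE CENTRAL CUBE IS `S_k`-DEEP** (`P_μ ≥ 5`: the centre is at least `2S_k + S/2` from every wall).
[cite: Balaban1984PropagatorsII, (2.36) p.229 with (2.46) p.231, dictionary (charts)] -/
theorem siteDeep_of_dist_le (hMh : 1 ≤ Mh) (hP5 : ∀ μ, 5 ≤ P μ) {hP4 : ∀ μ, 4 ≤ P μ} (c : ↥(cubes D.toDomains)) {x : ↥(boxDom (N0 ℓ Mh k P))}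
    (h : dist (toR x.1) (ctr (Dch D c) (cc D hMh hP4 c)) ≤ 3 / 2 * (bigSide ℓ Mh c.1.1 : ℝ)) :
    SiteDeep (N0 ℓ Mh k P) (bigSide ℓ Mh k : ℤ) x.1 := by
  intro μ
  obtain ⟨h1, h2⟩ := ctr_cc_bounds hMh hP4 c μ
  have hP : (5 : ℝ) ≤ P μ := by exact_mod_cast hP5 μ
  have hμ := (dist_le_pi_dist (toR x.1) _ μ).trans h
  rw [Real.dist_eq, abs_le] at hμ
  have ex : toR x.1 μ = (x.1 μ : ℝ) := rfl
  rw [ex] at hμ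
  have hS : (bigSide ℓ Mh c.1.1 : ℝ) ≤ (bigSide ℓ Mh k : ℝ) := by rw [← side_cc hMh hP4 c]; exact side_le_bigSide_k _ _
  have hSk : (0 : ℝ) ≤ (bigSide ℓ Mh k : ℝ) := by positivity
  have hlo : (((bigSide ℓ Mh k : ℕ) : ℤ) : ℝ) ≤ ((x.1 μ : ℤ) : ℝ) := by rw [Int.cast_natCast]; nlinarith [hμ.1]
  have hhi : ((x.1 μ + ((bigSide ℓ Mh k : ℕ) : ℤ) : ℤ) : ℝ) ≤ (((N0 ℓ Mh k P μ : ℕ) : ℤ) : ℝ) := by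
    rw [Int.cast_add, Int.cast_natCast, Int.cast_natCast]; nlinarith [hμ.2]
  exact ⟨Int.cast_le.1 hlo, Int.cast_le.1 hhi⟩

/-- **THE BLOCKS CARRYING `supp h_□` ARE `S_k`-DEEP OF LEVEL `≤ j + 1`** (the `hdeep` input of `lip_transfer`; `M_h ≥ 2`, `R ≥ 2L`, `P_μ ≥ 5`).
[cite: Balaban1984PropagatorsII, (2.36) p.229, p.235, (2.46) p.231, dictionary (charts)] -/
theorem blkDeep_of_hF_ne_zero (hMh : 2 ≤ Mh) (hR : 2 * (ℓ + 1) ≤ R) (hP5 : ∀ μ, 5 ≤ P μ) {hMh1 : 1 ≤ Mh} {hP4 : ∀ μ, 4 ≤ P μ}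
    (c : ↥(cubes D.toDomains)) {x : ↥(boxDom (N0 ℓ Mh k P))} (h : hF (Dch D c) (cc D hMh1 hP4 c) x ≠ 0) :
    BlkDeep (Dch D c) (bigSide ℓ Mh k : ℤ) (blkOf (Dch D c) x) ∧ (blkOf (Dch D c) x).1.1 ≤ c.1.1 + 1 := by
  have hlev : (blkOf (Dch D c) x).1.1 ≤ c.1.1 + 1 := (lev_window_of_hF_ne_zero (Dch D c) hMh1 hR h).2
  refine ⟨fun x' hx' => ?_, hlev⟩
  have hx := dist_lt_of_hF_ne_zero (Dch D c) hMh1 h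
  rw [side_cc] at hx
  have h1 := dist_toR_cen_le (Dch D c) hx'
  have h2 := dist_toR_cen_le (Dch D c) (rfl : blkOf (Dch D c) x = blkOf (Dch D c) x)
  have hpow := pow_le_half_bigSide (ℓ := ℓ) hMh hlev
  refine siteDeep_of_dist_le (hP4 := hP4) hMh1 hP5 c ?_
  linarith [dist_triangle (toR x'.1) (cen (Dch D c) (blkOf (Dch D c) x)) (ctr (Dch D c) (cc D hMh1 hP4 c)),
    dist_triangle (cen (Dch D c) (blkOf (Dch D c) x)) (toR x.1) (ctr (Dch D c) (cc D hMh1 hP4 c)),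
    dist_comm (cen (Dch D c) (blkOf (Dch D c) x)) (toR x.1)]

/-- **THE BLOCKS OF `□⁺ = Q` ARE `S_k`-DEEP OF LEVEL `≤ j + 1`** (the `hdeep` input of `gap_transfer`). [cite: Balaban1984PropagatorsII, p.235, (2.46) p.231, dictionary (charts)] -/
theorem blkDeep_of_mem_Q (hMh : 2 ≤ Mh) (hR : 2 * (ℓ + 1) ≤ R) (hP5 : ∀ μ, 5 ≤ P μ) {hMh1 : 1 ≤ Mh} {hP4 : ∀ μ, 4 ≤ P μ}
    (c : ↥(cubes D.toDomains)) {b : ↥(bset (Dch D c))} (hb : b ∈ Q (Dch D c) (cc D hMh1 hP4 c)) :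
    BlkDeep (Dch D c) (bigSide ℓ Mh k : ℤ) b ∧ b.1.1 ≤ c.1.1 + 1 := by
  have hlev : b.1.1 ≤ c.1.1 + 1 := (window (Dch D c) hMh1 hR hb).2
  refine ⟨fun x' hx' => ?_, hlev⟩
  have hQ := (mem_Q (Dch D c)).1 hb
  rw [side_cc] at hQ
  have h1 := dist_toR_cen_le (Dch D c) hx'
  have hpow := pow_le_half_bigSide (ℓ := ℓ) hMh hlev
  refine siteDeep_of_dist_le (hP4 := hP4) hMh1 hP5 c ?_
  linarith [dist_triangle (toR x'.1) (cen (Dch D c) b) (ctr (Dch D c) (cc D hMh1 hP4 c))]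

end Depth

/-! ## §2b  The two-level window of the collar (r03's `hlev`) -/

section Levels

variable {D : TDomains d ℓ Mh k P R}

open Literature.MathematicalPhysics.QuantumFieldTheory.Balaban1983to89.B4ContourShift (supNorm)
open Literature.MathematicalPhysics.QuantumFieldTheory.Balaban1983to89.B6Geom246MultiLevelBox (supNorm_eq_dist)
open Literature.MathematicalPhysics.QuantumFieldTheory.Balaban1983to89.B6Cover236MultiLevelBlocksL0 (wit lev_wit blk_wit dist_toR_ctr_le)
open Literature.MathematicalPhysics.QuantumFieldTheory.Balaban1983to89.B6Partition118KLevelFineL0 (lev_window_of_dist_lt_three_halves)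

/-- a chart site within `3S/2` of the centre of the central cube is within `2S` (sup norm) of the cube's witness (a chart site of level `j` in the big block).
[cite: Balaban1984PropagatorsII, p.229 («with a center y ∈ Λ_j»), bookkeeping] -/
theorem supNorm_sub_wit_lt (hMh : 1 ≤ Mh) (hP4 : ∀ μ, 4 ≤ P μ) (c : ↥(cubes D.toDomains)) {w : ↥(boxDom (N0 ℓ Mh k P))}
    (hw : dist (toR w.1) (ctr (Dch D c) (cc D hMh hP4 c)) < 3 / 2 * (bigSide ℓ Mh c.1.1 : ℝ)) :
    supNorm (w.1 - (wit (Dch D c) (cc D hMh hP4 c)).1) < 2 * (bigSide ℓ Mh c.1.1 : ℝ) := by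
  have hwit : dist (toR (wit (Dch D c) (cc D hMh hP4 c)).1) (ctr (Dch D c) (cc D hMh hP4 c)) ≤ (bigSide ℓ Mh c.1.1 : ℝ) / 2 := by
    rw [← side_cc hMh hP4 c]; exact dist_toR_ctr_le (Dch D c) hMh (blk_wit (Dch D c) (cc D hMh hP4 c))
  rw [supNorm_eq_dist]
  linarith [dist_triangle_right (toR w.1) (toR (wit (Dch D c) (cc D hMh hP4 c)).1) (ctr (Dch D c) (cc D hMh hP4 c))]

/-- **THE TWO-LEVEL WINDOW OF THE COLLAR**: there is `j₀ ∈ {j − 1, j}` such that every chart site within `3S/2` of the centre of the central cube has chart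
level `j₀` or `j₀ + 1` ((2.2) at the witness: levels in `[j − 1, j + 1]`, and never both `j − 1` and `j + 1` — p21's `B6MultiLevelBoxOperatorL0.Domains.not_both_sides`); the torus
level of `σ_c w` is this chart level (`B6MultiLevelTorusOperatorL0.TDomains.chart_lev`).  The `hlev` input of r03's `…B6IndexCorrV1.hagree_domT` for any window inside the collar.
[cite: Balaban1984PropagatorsII, (2.2) p.224, p.230 («□ … intersecting maybe the domain B^{j+1}(Λ_{j+1})»), p.235] -/
theorem two_level_collar (hℓ : 1 ≤ ℓ) (hMh : 1 ≤ Mh) (hR : 2 * (ℓ + 1) ≤ R) (hP4 : ∀ μ, 4 ≤ P μ) (c : ↥(cubes D.toDomains)) :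
    ∃ j₀ : ℕ, (j₀ + 1 = c.1.1 ∨ j₀ = c.1.1) ∧ ∀ w : ↥(boxDom (N0 ℓ Mh k P)),
      dist (toR w.1) (ctr (Dch D c) (cc D hMh hP4 c)) < 3 / 2 * (bigSide ℓ Mh c.1.1 : ℝ) →
        j₀ ≤ (Dch D c).lev w.1 ∧ (Dch D c).lev w.1 ≤ j₀ + 1 := by
  have hlw : (Dch D c).lev (wit (Dch D c) (cc D hMh hP4 c)).1 = c.1.1 := lev_wit (Dch D c) (cc D hMh hP4 c)
  have win : ∀ w : ↥(boxDom (N0 ℓ Mh k P)), dist (toR w.1) (ctr (Dch D c) (cc D hMh hP4 c)) < 3 / 2 * (bigSide ℓ Mh c.1.1 : ℝ) →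
      c.1.1 ≤ (Dch D c).lev w.1 + 1 ∧ (Dch D c).lev w.1 ≤ c.1.1 + 1 := fun w hw =>
    lev_window_of_dist_lt_three_halves (Dch D c) hMh hR (i := cc D hMh hP4 c) (by rw [side_cc]; exact hw)
  by_cases hdown : ∃ w₀ : ↥(boxDom (N0 ℓ Mh k P)),
      dist (toR w₀.1) (ctr (Dch D c) (cc D hMh hP4 c)) < 3 / 2 * (bigSide ℓ Mh c.1.1 : ℝ) ∧ (Dch D c).lev w₀.1 + 1 = c.1.1
  · obtain ⟨w₀, hw₀, hl₀⟩ := hdown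
    refine ⟨c.1.1 - 1, Or.inl (by omega), fun w hw => ?_⟩
    have hwin := win w hw
    have hne : (Dch D c).lev w.1 ≠ c.1.1 + 1 := fun h =>
      (Dch D c).not_both_sides hℓ hR w₀.2 w.2 (supNorm_sub_wit_lt hMh hP4 c hw₀) (supNorm_sub_wit_lt hMh hP4 c hw) hl₀ h
    constructor <;> omega
  · push Not at hdown
    refine ⟨c.1.1, Or.inr rfl, fun w hw => ?_⟩
    have hwin := win w hw
    have hne := hdown w hw
    constructor <;> omega

/-- the same read on the torus: the torus level of `σ_c w` is the chart level of `w`. [cite: Balaban1984PropagatorsII, (2.3)–(2.4) p.224, dictionary (charts)] -/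
theorem lev_σch (c : ↥(cubes D.toDomains)) (w : ↥(boxDom (N0 ℓ Mh k P))) : D.lev (σch D c w).1 = (Dch D c).lev w.1 := by
  show D.lev (σch D c w).1 = (D.chart (svec ℓ k c.1.1 c.1.2)).lev w.1
  rw [D.chart_lev]

end Levels

/-! ## §3  The supports `S_□`, the cut-off sets `□̃` and `ζ_□` as torus blocks -/

section Sets

variable (D : TDomains d ℓ Mh k P R)

/-- **`S_□ := □⁺` ON THE TORUS**: the torus blocks of the chart blocks `Q` of the central cube. [cite: Balaban1984PropagatorsII, p.235, (2.134) p.247] -/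
noncomputable def QT (hMh : 1 ≤ Mh) (hP4 : ∀ μ, 4 ≤ P μ) (c : ↥(cubes D.toDomains)) : Finset ↥(bset D.toDomains) :=
  (Q (Dch D c) (cc D hMh hP4 c)).image (blkMap D (svec ℓ k c.1.1 c.1.2))

/-- **`Score_□ := □̃` ON THE TORUS**: the torus blocks of the chart blocks `Qbig` of the central cube. [cite: Balaban1984PropagatorsII, p.239 («ζ_□ ∈ C₀^∞(□̃)»), (2.134) p.247] -/
noncomputable def QbigT (hMh : 1 ≤ Mh) (hP4 : ∀ μ, 4 ≤ P μ) (c : ↥(cubes D.toDomains)) : Finset ↥(bset D.toDomains) :=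
  (Qbig (Dch D c) (cc D hMh hP4 c)).image (blkMap D (svec ℓ k c.1.1 c.1.2))

open Classical in
/-- **`ζ_□` ON THE TORUS**: the indicator of the blocks of `□̃`. [cite: Balaban1984PropagatorsII, p.239 («the corresponding family of functions ζ_□»)] -/
noncomputable def zetaT (hMh : 1 ≤ Mh) (hP4 : ∀ μ, 4 ≤ P μ) (c : ↥(cubes D.toDomains)) (z : ↥(boxDom (N0 ℓ Mh k P))) : ℝ :=
  if blkOf D.toDomains z ∈ QbigT D hMh hP4 c then 1 else 0

variable {D}

/-- `S_□ ⊆ Score_□`. [cite: Balaban1984PropagatorsII, p.239, bookkeeping] -/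
theorem QT_subset_QbigT (hMh : 1 ≤ Mh) (hP4 : ∀ μ, 4 ≤ P μ) (c : ↥(cubes D.toDomains)) : QT D hMh hP4 c ⊆ QbigT D hMh hP4 c :=
  Finset.image_subset_image (Q_subset_Qbig _ hMh _)

/-- **`hhS`: `supp h^T_□` MEETS ONLY BLOCKS OF `S_□`** (`M_h ≥ 2`, `R ≥ 2L`). [cite: Balaban1984PropagatorsII, p.235, (2.134) p.247] -/
theorem blkOf_mem_QT_of_hT_ne_zero (hMh : 2 ≤ Mh) (hR : 2 * (ℓ + 1) ≤ R) {hMh1 : 1 ≤ Mh} (hP4 : ∀ μ, 4 ≤ P μ) (c : ↥(cubes D.toDomains))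
    {z : ↥(boxDom (N0 ℓ Mh k P))} (h : hT D c z ≠ 0) : blkOf D.toDomains z ∈ QT D hMh1 hP4 c := by
  rw [hT_eq_hF_cc hMh1 hP4 c z] at h
  unfold QT
  rw [blkOf_eq_blkMap_symm (D := D) hMh1 (one_le_of_four_le hP4) (svec ℓ k c.1.1 c.1.2) z]
  exact Finset.mem_image_of_mem _ (blkOf_mem_Q_of_hF_ne_zero _ hMh hR h)

/-- `ζ ≥ 0`. [cite: Balaban1984PropagatorsII, p.239, bookkeeping] -/
theorem zetaT_nonneg (hMh : 1 ≤ Mh) (hP4 : ∀ μ, 4 ≤ P μ) (c : ↥(cubes D.toDomains)) (z : ↥(boxDom (N0 ℓ Mh k P))) : 0 ≤ zetaT D hMh hP4 c z := by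
  unfold zetaT; split_ifs <;> norm_num

/-- `ζ ≤ 1`. [cite: Balaban1984PropagatorsII, p.239, bookkeeping] -/
theorem zetaT_le_one (hMh : 1 ≤ Mh) (hP4 : ∀ μ, 4 ≤ P μ) (c : ↥(cubes D.toDomains)) (z : ↥(boxDom (N0 ℓ Mh k P))) : zetaT D hMh hP4 c z ≤ 1 := by
  unfold zetaT; split_ifs <;> norm_num

/-- **`hζS`: `ζ_□(z) ≠ 1 ⟹ y(z) ∉ Score_□`.** [cite: Balaban1984PropagatorsII, p.247 («ζ_□(y) − 1 = 0 for d(y,y′) ≦ M»)] -/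
theorem not_mem_QbigT_of_zetaT_ne_one (hMh : 1 ≤ Mh) (hP4 : ∀ μ, 4 ≤ P μ) (c : ↥(cubes D.toDomains)) {z : ↥(boxDom (N0 ℓ Mh k P))}
    (h : zetaT D hMh hP4 c z ≠ 1) : blkOf D.toDomains z ∉ QbigT D hMh hP4 c := by
  intro hz; apply h; unfold zetaT; rw [if_pos hz]

/-- `ζ_□ = 1` on the blocks of `Score_□`. [cite: Balaban1984PropagatorsII, p.247, bookkeeping] -/
theorem zetaT_eq_one (hMh : 1 ≤ Mh) (hP4 : ∀ μ, 4 ≤ P μ) (c : ↥(cubes D.toDomains)) {z : ↥(boxDom (N0 ℓ Mh k P))}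
    (hz : blkOf D.toDomains z ∈ QbigT D hMh hP4 c) : zetaT D hMh hP4 c z = 1 := by
  unfold zetaT; rw [if_pos hz]

/-- `ζ_□·h^T_□ = h^T_□`. [cite: Balaban1984PropagatorsII, p.239 (2.91) («ζ_□h_□ = h_□»), bookkeeping] -/
theorem zetaT_mul_hT (hMh : 2 ≤ Mh) (hR : 2 * (ℓ + 1) ≤ R) {hMh1 : 1 ≤ Mh} (hP4 : ∀ μ, 4 ≤ P μ) (c : ↥(cubes D.toDomains))
    (z : ↥(boxDom (N0 ℓ Mh k P))) : zetaT D hMh1 hP4 c z * hT D c z = hT D c z := by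
  by_cases h : hT D c z = 0
  · rw [h, mul_zero]
  · rw [zetaT_eq_one hMh1 hP4 c (QT_subset_QbigT hMh1 hP4 c (blkOf_mem_QT_of_hT_ne_zero hMh hR hP4 c h)), one_mul]

end Sets

end Literature.MathematicalPhysics.QuantumFieldTheory.Balaban1983to89.B6Partition118KLevelTorusCentralL0
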